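import Literature.NumberTheory.Automorphic.ArchEndoscopicChartOrbUnfoldLeaves      -- ★ p850744 (α1): `exists_placeLeaf_explicit`, `exists_placeLeaves_archRH_mul_chartOrbH_eq(_of_isHaarMeasure)`; brings ★ p850514 UnfoldSplit, ★ scaling, ★ product-quotient package
import Literature.NumberTheory.Automorphic.ArchEndoscopicChartOrbLocalCongr       -- ★ (T-CONGR): `endoBlockAt_eq_of_mem_iff`, `chartTorusHLoc_eq_of_mem_iff`, ★ `quotientMeasure_eq_inv_smul_of_eq_smul` (via ChartOrbFree)
import HarnessLib

/-!
# UNIFORM UNFOLDING, PER-PLACE FORM — THE LEAVES AS HYPOTHESES: the identity `archRH · chartOrbH = K₀ · E_S · ∫ fH d(⊗_w Λ_w)` on `RegS S` for ANY per-place leaf packages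
# `(Λ_w, Z_w, C_w)` satisfying ★ (α1)'s per-place clauses, and the transport of a per-place leaf identity to EQUAL local data (another label `S′` with `w ∈ S ↔ w ∈ S′`)
# ((JH-A) «two-chart leaves», input form of ★ `exists_placeLeaves_archRH_mul_chartOrbH_eq`; Varadarajan 1989 §6.4, Shelstad 1979 §4, Folland 1995 §2.6, Deitmar–Echterhoff Thm. 1.5.3)

Topic `NumberTheory/Automorphic`; namespace `Literature.NumberTheory.Automorphic.UnitaryGroup`.  THEOREMS ONLY (no `def`, no instance, no notation beyond the file-local
abbreviations of ★ (α1), no axiom, no `sorry`).  Cell `pub/hodgecm-mathlib`, crux H413 (`stmt-HodgeConjecture-24833`), line LH3 (closer stub `stub_N9`, DIRECT ROAD),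
organ L3′ forward half (J)-H, brick **(JH-A)** «two-chart leaves» (JH-SPEC v1 of LH3-p01 (g5); dealer LH3-plan (g4)).  Author LH10-p02 (g7).  Count-neutral.

WHY.  ★ `exists_placeLeaves_archRH_mul_chartOrbH_eq` CHOOSES its per-place leaves inside the proof (★ `exists_placeLeaf_explicit`, one `choose`) and exports only
their consequences; a consumer who must run the SAME leaves through TWO charts (`S` and `insert w₀ S`, which differ at the single place `w₀` — the wall-normal jump of
the stable family, (J)-H) cannot re-enter the existential.  This file re-runs the assembly with the leaves GIVEN, and with the constant `K₀` produced BEFORE the test function `fH` (binder order (B2) of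
JH-SPEC v2 (R-A): the (J)-H jump constant is socketed before `fH`):
* §1 **`exists_smul_map_descConj_quotientMeasure_of_eq`** — generic: for EQUAL closed subgroups `T = T′` with inversion-invariant Haar measures `t`, `t′` and equal
  central elements `γ = γ′`, the orbital measures `(descConj γ′ T′)_* (ν ∕ t′)` and `(descConj γ T)_* (ν ∕ t)` on `G` differ by ONE positive scalar `κ` (Haar uniqueness
  on the torus, ★ `quotientMeasure_eq_inv_smul_of_eq_smul`), uniformly in `γ` — the measure-level twin of ★ `toReal_mul_integral_descConj_quotientMeasure_eq_of_eq`;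
* §2 **`exists_archRH_mul_chartOrbH_eq_of_placeLeaves`** (product Haar convention) — for leaves `Λ_w` finite on compacta carried by `Z_w` (null complement), proper at
  the points of `RegS S`, with the per-place LEAF IDENTITIES `(descConj γ_w(c) T_{S,w})_* (ν_w ∕ dt_w) = (C_w · [w ∈ S ? ‖e^{−2c_w0} − 1‖⁻¹ : 1]) • (z ↦ z₁ γ_w(c) z₂ z₁⁻¹)_* Λ_w`
  (the last clause of ★ `exists_placeLeaf`), there is `K₀` with `archRH S c · chartOrbH L νH S fH c = K₀ · E_S(c) · ∫ fH(eA⁻¹(z_{w,1} γ_w(c) z_{w,2} z_{w,1}⁻¹)_w, b(c)) d(⊗_w Λ_w)`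
  on `RegS S` — the proof of ★ (α1) verbatim with the `choose` replaced by the hypotheses;
* §3 **`…_of_isHaarMeasure`** — the same for an arbitrary Haar measure `νH` (★ `chartOrbH_eq_haarScalarFactor_mul`).
HONEST LABEL: HC_CM is proved only modulo the 7 printed citations (2 remaining: hLiu418 = stmt-HodgeConjecture-24832, h413 = stmt-HodgeConjecture-24833) until rung 0
closes; measure-theoretic bookkeeping over ★ (α1), pays nothing by itself.

## References
* [Varadarajan1989] V. S. Varadarajan, *An Introduction to Harmonic Analysis on Semisimple Lie Groups* (1989), §6.4 Lemma 21, Thm 23.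
* [Shelstad1979] D. Shelstad, *Characters and inner forms of a quasi-split group over ℝ*, Compositio Math. 39 (1979), §4 pp. 22–25.
* [Folland1995] G. B. Folland, *A Course in Abstract Harmonic Analysis* (1995), §2.2; §2.6 Thm. 2.49, (2.52).
* [DeitmarEchterhoff2014] A. Deitmar, S. Echterhoff, *Principles of Harmonic Analysis*, 2nd ed. (2014), Thm. 1.5.3, Cor. 1.5.4.
* [BorelJacquet1979] A. Borel, H. Jacquet, *Automorphic forms and automorphic representations*, PSPM 33.1 (1979), §4.1.
-/

set_option autoImplicit false

noncomputable section

open MeasureTheory MeasureTheory.Measure NumberField NumberField.InfinitePlace Matrix Complex Topology Set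
open Literature.MeasureTheory.Group Literature.NumberTheory.Automorphic.ArchCartan
open scoped MatrixGroups Matrix ENNReal NNReal ComplexConjugate Classical Pointwise

namespace Literature.NumberTheory.Automorphic.UnitaryGroup

local notation3 "Φ₂[" L "]" => (Matrix.of fun i j : Fin 2 => if i.val + j.val + 1 = 2 then (1 : L) else 0)
local notation3 "Φ₁[" L "]" => (Matrix.of fun i j : Fin 1 => if i.val + j.val + 1 = 1 then (1 : L) else 0)
local notation3 "𝔸[" L "]" => ↥(arch (↥(maximalRealSubfield L)) L (IsCMField.complexConj L) 2 Φ₂[L])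
local notation3 "𝔹[" L "]" => ↥(arch (↥(maximalRealSubfield L)) L (IsCMField.complexConj L) 1 Φ₁[L])

/-! ## §1 Generic: orbital measures over EQUAL tori with two Haar normalisations differ by one positive scalar -/

section Generic

/-- **TRANSPORT OF THE QUOTIENT ORBITAL MEASURE TO EQUAL DATA.**  For a closed subgroup `T = T′` of a unimodular `G` (`ν` Haar and right invariant), inversion-invariant Haar
measures `t` on `T` and `t′` on `T′`, there is ONE scalar `κ ≠ 0` such that for all equal elements `γ = γ′` centralised by the torus
`(descConj γ′ T′)_* (ν ∕ t′) = κ • (descConj γ T)_* (ν ∕ t)` as measures on `G` (Haar uniqueness `t′ = c • t` on the torus and `ν ∕ (c • t) = c⁻¹ • (ν ∕ t)`, ★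
`quotientMeasure_eq_inv_smul_of_eq_smul`).  The equal data enter as SEPARATE variables, each side with its own Borel structure `borel _` on its quotient and its own
membership proofs, so that no dependent type is ever rewritten. [cite: DeitmarEchterhoff2014, Thm. 1.5.3; Cor. 1.5.4] [cite: Folland1995, §2.6 Thm. 2.49, (2.52)] -/
theorem exists_smul_map_descConj_quotientMeasure_of_eq
    {G : Type*} [Group G] [TopologicalSpace G] [IsTopologicalGroup G] [LocallyCompactSpace G] [SecondCountableTopology G] [T2Space G]
    [MeasurableSpace G] [BorelSpace G] (ν : Measure G) [ν.IsHaarMeasure] [ν.IsMulRightInvariant]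
    {T T' : Subgroup G} (hTT' : T = T') (hT : IsClosed (T : Set G)) (hT' : IsClosed (T' : Set G))
    (t : Measure ↥T) [t.IsHaarMeasure] [t.IsInvInvariant] (t' : Measure ↥T') [t'.IsHaarMeasure] [t'.IsInvInvariant] :
    ∃ κ : ℝ≥0, κ ≠ 0 ∧ ∀ (γ γ' : G) (_ : γ = γ') (hγ : ∀ m ∈ T, m * γ = γ * m) (hγ' : ∀ m ∈ T', m * γ' = γ' * m),
      (letI : MeasurableSpace (G ⧸ T') := borel _
       haveI : BorelSpace (G ⧸ T') := ⟨rfl⟩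
       Measure.map (descConj γ' T' hγ' id) (quotientMeasure T' t' hT' ν)) =
      κ • (letI : MeasurableSpace (G ⧸ T) := borel _
           haveI : BorelSpace (G ⧸ T) := ⟨rfl⟩
           Measure.map (descConj γ T hγ id) (quotientMeasure T t hT ν)) := by
  subst hTT'
  letI : MeasurableSpace (G ⧸ T) := borel _
  haveI : BorelSpace (G ⧸ T) := ⟨rfl⟩
  haveI : LocallyCompactSpace ↥T := hT.isClosedEmbedding_subtypeVal.locallyCompactSpace
  -- Haar uniqueness on `T`: `t' = c • t`, and the quotient measure scales inversely
  set c : ℝ≥0 := haarScalarFactor t' t with hcdef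
  have hc : c ≠ 0 := (haarScalarFactor_pos_of_isHaarMeasure t' t).ne'
  have ht : t' = c • t := isMulLeftInvariant_eq_smul t' t
  have hQ : quotientMeasure T t' hT ν = c⁻¹ • quotientMeasure T t hT ν := quotientMeasure_eq_inv_smul_of_eq_smul T hT t t' ν hc ht
  refine ⟨c⁻¹, inv_ne_zero hc, fun γ γ' hγγ' hγ hγ' => ?_⟩
  subst hγγ'
  -- the two membership ∕ closedness proofs are irrelevant
  change Measure.map (descConj γ T hγ id) (quotientMeasure T t' hT ν) = c⁻¹ • Measure.map (descConj γ T hγ id) (quotientMeasure T t hT ν)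
  rw [hQ, Measure.map_smul]

/-- A measure carried by a leaf `Z` (null complement) on which a continuous map is proper AT THE RELEVANT COMPACTA is pushed forward to a measure finite on compacta (local
copy of the private helper of ★ (α1)). [folklore] -/
private theorem isFiniteMeasureOnCompacts_map_of_leaf'' {X Y : Type*} [TopologicalSpace X] [MeasurableSpace X] [BorelSpace X] [TopologicalSpace Y] [T2Space Y]
    [MeasurableSpace Y] [BorelSpace Y] (μ : Measure X) [IsFiniteMeasureOnCompacts μ] {Z : Set X} (hZ : μ Zᶜ = 0) {m : X → Y} (hm : Continuous m)
    (hprop : ∀ C : Set Y, IsCompact C → ∃ 𝒮 : Set X, IsCompact 𝒮 ∧ ∀ z ∈ Z, m z ∈ C → z ∈ 𝒮) : IsFiniteMeasureOnCompacts (μ.map m) := by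
  refine ⟨fun C hC => ?_⟩
  obtain ⟨𝒮, h𝒮, h⟩ := hprop C hC
  rw [Measure.map_apply hm.measurable hC.measurableSet]
  have hsub : m ⁻¹' C ⊆ 𝒮 ∪ Zᶜ := fun z hz => by
    by_cases hzZ : z ∈ Z
    · exact Or.inl (h z hzZ hz)
    · exact Or.inr hzZ
  calc μ (m ⁻¹' C) ≤ μ (𝒮 ∪ Zᶜ) := measure_mono hsub
    _ ≤ μ 𝒮 + μ Zᶜ := measure_union_le _ _
    _ < ⊤ := by rw [hZ, add_zero]; exact h𝒮.measure_lt_top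

end Generic

/-! ## §2 The assembly over all places for GIVEN leaves (product Haar convention) -/

section Assembly

variable (L : Type) [Field L] [NumberField L] [IsCMField L] (S : Finset {w : InfinitePlace L // IsComplex w})
  [∀ w : {w : InfinitePlace L // IsComplex w}, MeasurableSpace ↥(archLocal L 2 Φ₂[L] w)]
  [∀ w : {w : InfinitePlace L // IsComplex w}, BorelSpace ↥(archLocal L 2 Φ₂[L] w)]
  [∀ w : {w : InfinitePlace L // IsComplex w}, LocallyCompactSpace ↥(archLocal L 2 Φ₂[L] w)]
  [∀ w : {w : InfinitePlace L // IsComplex w}, SecondCountableTopology ↥(archLocal L 2 Φ₂[L] w)]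
  [∀ w : {w : InfinitePlace L // IsComplex w}, MeasurableSpace (↥(archLocal L 2 Φ₂[L] w) ⧸ chartTorusHLoc L S w)]
  [∀ w : {w : InfinitePlace L // IsComplex w}, BorelSpace (↥(archLocal L 2 Φ₂[L] w) ⧸ chartTorusHLoc L S w)]
  [∀ w : {w : InfinitePlace L // IsComplex w}, (chartHaarHLoc L S w).IsHaarMeasure]
  [∀ w : {w : InfinitePlace L // IsComplex w}, (chartHaarHLoc L S w).IsInvInvariant]
  [MeasurableSpace 𝔸[L]] [BorelSpace 𝔸[L]] [MeasurableSpace 𝔹[L]] [BorelSpace 𝔹[L]]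
  (νw : ∀ w : {w : InfinitePlace L // IsComplex w}, Measure ↥(archLocal L 2 Φ₂[L] w)) [∀ w, (νw w).IsHaarMeasure] [∀ w, (νw w).IsMulRightInvariant]
  (νB : Measure 𝔹[L]) [νB.IsHaarMeasure] [νB.IsMulRightInvariant]
  (νH : Measure (𝔸[L] × 𝔹[L])) [νH.IsHaarMeasure] [νH.IsMulRightInvariant]
  (hν : νH = ((Measure.pi νw).map (archPiEquivCM 2 L Φ₂[L]).symm).prod νB)

set_option maxHeartbeats 400000 in
include hν in
/-- **UNIFORM UNFOLDING FOR GIVEN LEAVES (product Haar convention).**  Let `νH = (eA⁻¹_* ⊗_w ν_w) ⊗ ν_B`, `fH` continuous, and let per-place leaves be GIVEN: measures `Λ_w`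
on `G_w × G_w` finite on compacta carried by sets `Z_w` (null complement), proper at every point of `RegS S` (`{z ∈ Z_w | z₁ γ_w(c) z₂ z₁⁻¹ ∈ C′}` relatively compact for compact
`C′`), and scalars `C_w` with the per-place LEAF IDENTITIES of ★ `exists_placeLeaf` (`(descConj γ_w(c) T_{S,w})_* (ν_w ∕ dt_w) = (C_w · [w ∈ S ? ‖e^{−2c_w0} − 1‖⁻¹ : 1]) •
(z ↦ z₁ γ_w(c) z₂ z₁⁻¹)_* Λ_w` whenever `w ∈ S → c_w0 ≠ 0`).  Then for some `K₀ : ℝ` — chosen BEFORE the test function (it is `ρ(box) · Π_w C_w` for the product-quotient Haar measure `ρ`) — every continuous `fH` and every `c ∈ RegS S`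
`archRH S c · chartOrbH L νH S fH c = K₀ · (Π_w [w ∈ S ? e^{c_w0} : 1 − e^{i(c_w2 − c_w0)}]) · ∫ fH(eA⁻¹ (z_{w,1} · (endoBlockAt S w (c w) · z_{w,2}) · z_{w,1}⁻¹)_w, (endoTorus L S c).2) d(⊗_w Λ_w)(z)`
(the proof of ★ `exists_placeLeaves_archRH_mul_chartOrbH_eq`, leaves supplied instead of chosen). [cite: Varadarajan1989, §6.4 Lemma 21, Thm 23] [cite: Shelstad1979, §4 pp. 22–25]
[cite: Folland1995, §2.6 (2.52)] [cite: BorelJacquet1979, §4.1] -/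
theorem exists_archRH_mul_chartOrbH_eq_of_placeLeaves
    (Λw : ∀ w : {w : InfinitePlace L // IsComplex w}, Measure (↥(archLocal L 2 Φ₂[L] w) × ↥(archLocal L 2 Φ₂[L] w))) [∀ w, IsFiniteMeasureOnCompacts (Λw w)]
    (Zw : ∀ w : {w : InfinitePlace L // IsComplex w}, Set (↥(archLocal L 2 Φ₂[L] w) × ↥(archLocal L 2 Φ₂[L] w))) (hZnull : ∀ w, Λw w (Zw w)ᶜ = 0)
    (Cw : {w : InfinitePlace L // IsComplex w} → ℝ≥0)
    (hprop : ∀ (w) (c : {w : InfinitePlace L // IsComplex w} → Fin 3 → ℝ), c ∈ RegS S → ∀ C' : Set ↥(archLocal L 2 Φ₂[L] w), IsCompact C' →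
      ∃ 𝒮 : Set (↥(archLocal L 2 Φ₂[L] w) × ↥(archLocal L 2 Φ₂[L] w)), IsCompact 𝒮 ∧ ∀ z ∈ Zw w, z.1 * (endoBlockAt L S w (c w) * z.2) * z.1⁻¹ ∈ C' → z ∈ 𝒮)
    (hleaf : ∀ (w) (c : {w : InfinitePlace L // IsComplex w} → Fin 3 → ℝ), (w ∈ S → c w 0 ≠ 0) →
      Measure.map (descConj (endoBlockAt L S w (c w)) (chartTorusHLoc L S w) (forall_mem_chartTorusHLoc_comm L S w (c w)) id)
          (quotientMeasure (chartTorusHLoc L S w) (chartHaarHLoc L S w) (isClosed_chartTorusHLoc L S w) (νw w)) =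
        (Cw w * (if w ∈ S then ‖(((Real.exp (-2 * c w 0) : ℝ) : ℂ)) - 1‖₊⁻¹ else 1)) •
          Measure.map (fun z : ↥(archLocal L 2 Φ₂[L] w) × ↥(archLocal L 2 Φ₂[L] w) => z.1 * (endoBlockAt L S w (c w) * z.2) * z.1⁻¹) (Λw w)) :
    ∃ K₀ : ℝ, ∀ fH : 𝔸[L] × 𝔹[L] → ℂ, Continuous fH → ∀ c : {w : InfinitePlace L // IsComplex w} → Fin 3 → ℝ, c ∈ RegS S →
      archRH S c * chartOrbH L νH S fH c =
        (K₀ : ℂ) * (∏ w, (if w ∈ S then ((Real.exp (c w 0) : ℝ) : ℂ) else 1 - (Circle.exp (c w 2 - c w 0) : ℂ))) *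
          ∫ z, fH ((archPiEquivCM 2 L Φ₂[L]).symm (fun w => (z w).1 * (endoBlockAt L S w (c w) * (z w).2) * (z w).1⁻¹), (endoTorus L S c).2)
            ∂(Measure.pi Λw) := by
  -- instances at the places, on the quotients, on the chart tori
  letI : MeasurableSpace ((𝔸[L] × 𝔹[L]) ⧸ chartTorusH L S) := borel _
  haveI : BorelSpace ((𝔸[L] × 𝔹[L]) ⧸ chartTorusH L S) := ⟨rfl⟩
  haveI : ∀ w, SigmaFinite (chartHaarHLoc L S w) := fun w => sigmaFinite_chartHaarHLoc L S w
  haveI : νB.IsInvInvariant := isInvInvariant_of_isHaarMeasure_archOne L νB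
  haveI := locallyCompactSpace_chartTorusH L S
  -- the product-quotient package
  obtain ⟨ρ, hρH, hρI, -, hcov, -⟩ := exists_haar_quotientMeasure_prod_pi_top (archPiEquivCM 2 L Φ₂[L])
    (fun w => chartTorusHLoc L S w) (fun w => isClosed_chartTorusHLoc L S w) (chartTorusH L S) (isClosed_chartTorusH L S)
    (mem_chartTorusH_iff_forall_mem_chartTorusHLoc L S) (fun w => chartHaarHLoc L S w) νw νB νH hν
  refine ⟨(ρ (chartBoxImg L S)).toReal * ∏ w, (Cw w : ℝ), fun fH hfH c hc => ?_⟩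
  have hc1 : ∀ w, w ∈ S → c w 0 ≠ 0 := ((mem_regS_iff S c).1 hc).2
  -- (1) Haar-freeness + the package
  have hint : ∫ y, descConj (endoTorus L S c) (chartTorusH L S) (forall_mem_chartTorusH_comm L S c) fH y
      ∂(quotientMeasure (chartTorusH L S) ρ (isClosed_chartTorusH L S) νH) =
      ∫ p, fH ((archPiEquivCM 2 L Φ₂[L]).symm (fun w => descConj (endoBlockAt L S w (c w)) (chartTorusHLoc L S w)
        (forall_mem_chartTorusHLoc_comm L S w (c w)) id (p w)), (endoTorus L S c).2)
        ∂(Measure.pi fun w => quotientMeasure (chartTorusHLoc L S w) (chartHaarHLoc L S w) (isClosed_chartTorusHLoc L S w) (νw w)) :=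
    hcov (fun w => endoBlockAt L S w (c w)) (endoTorus L S c).2 (fun w => forall_mem_chartTorusHLoc_comm L S w (c w))
      (forall_mem_chartTorusH_comm L S c) fH
  -- (2) the orbital measures of the places and their leaves (`m w` the leaf parametrisation, `Φ` the integrand on `Π_w G_w`, `dsc` the scalars)
  let m : ∀ w : {w : InfinitePlace L // IsComplex w}, ↥(archLocal L 2 Φ₂[L] w) × ↥(archLocal L 2 Φ₂[L] w) → ↥(archLocal L 2 Φ₂[L] w) :=
    fun w z => z.1 * (endoBlockAt L S w (c w) * z.2) * z.1⁻¹
  have hm_c : ∀ w, Continuous (m w) := fun w => (continuous_fst.mul (continuous_const.mul continuous_snd)).mul continuous_fst.inv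
  let Φ : (∀ w : {w : InfinitePlace L // IsComplex w}, ↥(archLocal L 2 Φ₂[L] w)) → ℂ :=
    fun g => fH ((archPiEquivCM 2 L Φ₂[L]).symm g, (endoTorus L S c).2)
  have hΦ_c : Continuous Φ := hfH.comp (((archPiEquivCM 2 L Φ₂[L]).symm.continuous).prodMk continuous_const)
  let dsc : {w : InfinitePlace L // IsComplex w} → ℝ≥0 := fun w => Cw w * (if w ∈ S then ‖(((Real.exp (-2 * c w 0) : ℝ) : ℂ)) - 1‖₊⁻¹ else 1)
  have hD_c : Continuous (fun (p : ∀ w : {w : InfinitePlace L // IsComplex w}, ↥(archLocal L 2 Φ₂[L] w) ⧸ chartTorusHLoc L S w)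
      (w : {w : InfinitePlace L // IsComplex w}) =>
      descConj (endoBlockAt L S w (c w)) (chartTorusHLoc L S w) (forall_mem_chartTorusHLoc_comm L S w (c w)) id (p w)) :=
    continuous_pi fun w => (continuous_descConj (endoBlockAt L S w (c w)) (chartTorusHLoc L S w) _ continuous_id).comp (continuous_apply w)
  have hM_c : Continuous (fun (z : ∀ w : {w : InfinitePlace L // IsComplex w}, ↥(archLocal L 2 Φ₂[L] w) × ↥(archLocal L 2 Φ₂[L] w))
      (w : {w : InfinitePlace L // IsComplex w}) => m w (z w)) :=
    continuous_pi fun w => (hm_c w).comp (continuous_apply w)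
  have hO : ∀ w, (quotientMeasure (chartTorusHLoc L S w) (chartHaarHLoc L S w) (isClosed_chartTorusHLoc L S w) (νw w)).map
      (descConj (endoBlockAt L S w (c w)) (chartTorusHLoc L S w) (forall_mem_chartTorusHLoc_comm L S w (c w)) id) = dsc w • (Λw w).map (m w) :=
    fun w => hleaf w c (hc1 w)
  -- the leaf images are finite on compacta (properness at the single point `c`), hence σ-finite
  have hmfin : ∀ w, IsFiniteMeasureOnCompacts ((Λw w).map (m w)) := by
    intro w
    exact isFiniteMeasureOnCompacts_map_of_leaf'' (Λw w) (hZnull w) (hm_c w) fun C' hC' => hprop w c hc C' hC'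
  haveI : ∀ w, SigmaFinite ((Λw w).map (m w)) := fun w => by haveI := hmfin w; infer_instance
  haveI : ∀ w, SigmaFinite ((quotientMeasure (chartTorusHLoc L S w) (chartHaarHLoc L S w) (isClosed_chartTorusHLoc L S w) (νw w)).map
      (descConj (endoBlockAt L S w (c w)) (chartTorusHLoc L S w) (forall_mem_chartTorusHLoc_comm L S w (c w)) id)) := fun w => by
    rw [hO w]; haveI := hmfin w; infer_instance
  -- (3) assemble: package → image of the product of quotient measures → product of leaves → fold
  have hstep : ∫ p, fH ((archPiEquivCM 2 L Φ₂[L]).symm (fun w => descConj (endoBlockAt L S w (c w)) (chartTorusHLoc L S w)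
        (forall_mem_chartTorusHLoc_comm L S w (c w)) id (p w)), (endoTorus L S c).2)
        ∂(Measure.pi fun w => quotientMeasure (chartTorusHLoc L S w) (chartHaarHLoc L S w) (isClosed_chartTorusHLoc L S w) (νw w)) =
      (∏ w, dsc w) • ∫ z, fH ((archPiEquivCM 2 L Φ₂[L]).symm (fun w => (z w).1 * (endoBlockAt L S w (c w) * (z w).2) * (z w).1⁻¹), (endoTorus L S c).2)
        ∂(Measure.pi Λw) := by
    -- as an integral of `Φ` against the image measure, then `pi_map_pi`, the leaves, `pi_nnreal_smul_map`, and the fold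
    have h1 : (fun p : (∀ w : {w : InfinitePlace L // IsComplex w}, ↥(archLocal L 2 Φ₂[L] w) ⧸ chartTorusHLoc L S w) =>
        fH ((archPiEquivCM 2 L Φ₂[L]).symm (fun w => descConj (endoBlockAt L S w (c w)) (chartTorusHLoc L S w)
          (forall_mem_chartTorusHLoc_comm L S w (c w)) id (p w)), (endoTorus L S c).2)) =
        fun p => Φ (fun w => descConj (endoBlockAt L S w (c w)) (chartTorusHLoc L S w) (forall_mem_chartTorusHLoc_comm L S w (c w)) id (p w)) := rfl
    rw [h1, ← integral_map hD_c.measurable.aemeasurable hΦ_c.aestronglyMeasurable,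
      Measure.pi_map_pi (fun w => (continuous_descConj (endoBlockAt L S w (c w)) (chartTorusHLoc L S w) _ continuous_id).measurable.aemeasurable)]
    have h2 : (Measure.pi fun w => (quotientMeasure (chartTorusHLoc L S w) (chartHaarHLoc L S w) (isClosed_chartTorusHLoc L S w) (νw w)).map
        (descConj (endoBlockAt L S w (c w)) (chartTorusHLoc L S w) (forall_mem_chartTorusHLoc_comm L S w (c w)) id)) =
        Measure.pi fun w => dsc w • (Λw w).map (m w) := congrArg Measure.pi (funext hO)
    rw [h2, pi_nnreal_smul_map Λw m (fun w => (hm_c w).measurable) dsc, integral_smul_nnreal_measure,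
      integral_map hM_c.measurable.aemeasurable hΦ_c.aestronglyMeasurable]
  -- (4) scalars
  rw [chartOrbH_eq_of_isHaarMeasure L S νH ρ fH c]
  show archRH S c * (((ρ (chartBoxImg L S)).toReal : ℂ) * ∫ y, descConj (endoTorus L S c) (chartTorusH L S) (forall_mem_chartTorusH_comm L S c) fH y
      ∂(quotientMeasure (chartTorusH L S) ρ (isClosed_chartTorusH L S) νH)) = _
  rw [hint, hstep]
  have hfac : ∀ w, (if w ∈ S then ((|Real.exp (c w 0) - Real.exp (-c w 0)| : ℝ) : ℂ) else 1 - (Circle.exp (c w 2 - c w 0) : ℂ)) * ((dsc w : ℝ) : ℂ) =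
      ((Cw w : ℝ) : ℂ) * (if w ∈ S then ((Real.exp (c w 0) : ℝ) : ℂ) else 1 - (Circle.exp (c w 2 - c w 0) : ℂ)) := by
    intro w
    by_cases hw : w ∈ S
    · simp only [dsc, if_pos hw, NNReal.coe_mul, NNReal.coe_inv, coe_nnnorm, Complex.ofReal_mul, Complex.ofReal_inv]
      have h := abs_exp_sub_exp_neg_mul_norm_inv (c w 0) (hc1 w hw)
      calc ((|Real.exp (c w 0) - Real.exp (-c w 0)| : ℝ) : ℂ) * (((Cw w : ℝ) : ℂ) * (((‖(((Real.exp (-2 * c w 0) : ℝ) : ℂ)) - 1‖ : ℝ) : ℂ))⁻¹)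
          = ((Cw w : ℝ) : ℂ) * (((|Real.exp (c w 0) - Real.exp (-c w 0)| * ‖(((Real.exp (-2 * c w 0) : ℝ) : ℂ)) - 1‖⁻¹ : ℝ)) : ℂ) := by
            push_cast; ring
        _ = ((Cw w : ℝ) : ℂ) * ((Real.exp (c w 0) : ℝ) : ℂ) := by rw [h]
    · simp only [dsc, if_neg hw, mul_one]
      ring
  have harch : archRH S c = ∏ w, (if w ∈ S then ((|Real.exp (c w 0) - Real.exp (-c w 0)| : ℝ) : ℂ) else 1 - (Circle.exp (c w 2 - c w 0) : ℂ)) := by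
    unfold archRH
    exact Finset.prod_congr rfl fun w _ => by congr 1
  rw [NNReal.smul_def, Complex.real_smul, NNReal.coe_prod, Complex.ofReal_prod, harch, Complex.ofReal_mul, Complex.ofReal_prod]
  have hprod : (∏ w, (if w ∈ S then ((|Real.exp (c w 0) - Real.exp (-c w 0)| : ℝ) : ℂ) else 1 - (Circle.exp (c w 2 - c w 0) : ℂ))) * ∏ w, ((dsc w : ℝ) : ℂ) =
      (∏ w, ((Cw w : ℝ) : ℂ)) * ∏ w, (if w ∈ S then ((Real.exp (c w 0) : ℝ) : ℂ) else 1 - (Circle.exp (c w 2 - c w 0) : ℂ)) := by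
    rw [← Finset.prod_mul_distrib, ← Finset.prod_mul_distrib]
    exact Finset.prod_congr rfl fun w _ => hfac w
  calc (∏ w, (if w ∈ S then ((|Real.exp (c w 0) - Real.exp (-c w 0)| : ℝ) : ℂ) else 1 - (Circle.exp (c w 2 - c w 0) : ℂ))) *
        (((ρ (chartBoxImg L S)).toReal : ℂ) * ((∏ w, ((dsc w : ℝ) : ℂ)) *
          ∫ z, fH ((archPiEquivCM 2 L Φ₂[L]).symm (fun w => (z w).1 * (endoBlockAt L S w (c w) * (z w).2) * (z w).1⁻¹), (endoTorus L S c).2)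
            ∂(Measure.pi Λw)))
      = ((ρ (chartBoxImg L S)).toReal : ℂ) * (((∏ w, (if w ∈ S then ((|Real.exp (c w 0) - Real.exp (-c w 0)| : ℝ) : ℂ) else 1 - (Circle.exp (c w 2 - c w 0) : ℂ))) *
          ∏ w, ((dsc w : ℝ) : ℂ)) *
          ∫ z, fH ((archPiEquivCM 2 L Φ₂[L]).symm (fun w => (z w).1 * (endoBlockAt L S w (c w) * (z w).2) * (z w).1⁻¹), (endoTorus L S c).2)
            ∂(Measure.pi Λw)) := by ring
    _ = _ := by rw [hprod]; ring


end Assembly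

/-! ## §3 The same for an arbitrary Haar measure `νH` -/

section AnyHaar

variable (L : Type) [Field L] [NumberField L] [IsCMField L] (S : Finset {w : InfinitePlace L // IsComplex w})
  [∀ w : {w : InfinitePlace L // IsComplex w}, MeasurableSpace ↥(archLocal L 2 Φ₂[L] w)]
  [∀ w : {w : InfinitePlace L // IsComplex w}, BorelSpace ↥(archLocal L 2 Φ₂[L] w)]
  [∀ w : {w : InfinitePlace L // IsComplex w}, LocallyCompactSpace ↥(archLocal L 2 Φ₂[L] w)]
  [∀ w : {w : InfinitePlace L // IsComplex w}, SecondCountableTopology ↥(archLocal L 2 Φ₂[L] w)]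
  [∀ w : {w : InfinitePlace L // IsComplex w}, MeasurableSpace (↥(archLocal L 2 Φ₂[L] w) ⧸ chartTorusHLoc L S w)]
  [∀ w : {w : InfinitePlace L // IsComplex w}, BorelSpace (↥(archLocal L 2 Φ₂[L] w) ⧸ chartTorusHLoc L S w)]
  [∀ w : {w : InfinitePlace L // IsComplex w}, (chartHaarHLoc L S w).IsHaarMeasure]
  [∀ w : {w : InfinitePlace L // IsComplex w}, (chartHaarHLoc L S w).IsInvInvariant]
  [MeasurableSpace 𝔸[L]] [BorelSpace 𝔸[L]] [MeasurableSpace 𝔹[L]] [BorelSpace 𝔹[L]]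
  (νw : ∀ w : {w : InfinitePlace L // IsComplex w}, Measure ↥(archLocal L 2 Φ₂[L] w)) [∀ w, (νw w).IsHaarMeasure] [∀ w, (νw w).IsMulRightInvariant]
  (νH : Measure (𝔸[L] × 𝔹[L])) [νH.IsHaarMeasure] [νH.IsMulRightInvariant]

/-- **UNIFORM UNFOLDING FOR GIVEN LEAVES, ARBITRARY HAAR MEASURE `νH`** (★ `chartOrbH_eq_haarScalarFactor_mul` absorbs the Haar scalar into `K₀`; the auxiliary `ν_B` is
Mathlib's Haar measure of the compact `U(Φ₁)`-factor). [cite: Folland1995, §2.2; §2.6 (2.52)] [cite: Varadarajan1989, §6.4 Lemma 21, Thm 23] -/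
theorem exists_archRH_mul_chartOrbH_eq_of_placeLeaves_of_isHaarMeasure
    (Λw : ∀ w : {w : InfinitePlace L // IsComplex w}, Measure (↥(archLocal L 2 Φ₂[L] w) × ↥(archLocal L 2 Φ₂[L] w))) [∀ w, IsFiniteMeasureOnCompacts (Λw w)]
    (Zw : ∀ w : {w : InfinitePlace L // IsComplex w}, Set (↥(archLocal L 2 Φ₂[L] w) × ↥(archLocal L 2 Φ₂[L] w))) (hZnull : ∀ w, Λw w (Zw w)ᶜ = 0)
    (Cw : {w : InfinitePlace L // IsComplex w} → ℝ≥0)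
    (hprop : ∀ (w) (c : {w : InfinitePlace L // IsComplex w} → Fin 3 → ℝ), c ∈ RegS S → ∀ C' : Set ↥(archLocal L 2 Φ₂[L] w), IsCompact C' →
      ∃ 𝒮 : Set (↥(archLocal L 2 Φ₂[L] w) × ↥(archLocal L 2 Φ₂[L] w)), IsCompact 𝒮 ∧ ∀ z ∈ Zw w, z.1 * (endoBlockAt L S w (c w) * z.2) * z.1⁻¹ ∈ C' → z ∈ 𝒮)
    (hleaf : ∀ (w) (c : {w : InfinitePlace L // IsComplex w} → Fin 3 → ℝ), (w ∈ S → c w 0 ≠ 0) →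
      Measure.map (descConj (endoBlockAt L S w (c w)) (chartTorusHLoc L S w) (forall_mem_chartTorusHLoc_comm L S w (c w)) id)
          (quotientMeasure (chartTorusHLoc L S w) (chartHaarHLoc L S w) (isClosed_chartTorusHLoc L S w) (νw w)) =
        (Cw w * (if w ∈ S then ‖(((Real.exp (-2 * c w 0) : ℝ) : ℂ)) - 1‖₊⁻¹ else 1)) •
          Measure.map (fun z : ↥(archLocal L 2 Φ₂[L] w) × ↥(archLocal L 2 Φ₂[L] w) => z.1 * (endoBlockAt L S w (c w) * z.2) * z.1⁻¹) (Λw w)) :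
    ∃ K₀ : ℝ, ∀ fH : 𝔸[L] × 𝔹[L] → ℂ, Continuous fH → ∀ c : {w : InfinitePlace L // IsComplex w} → Fin 3 → ℝ, c ∈ RegS S →
      archRH S c * chartOrbH L νH S fH c =
        (K₀ : ℂ) * (∏ w, (if w ∈ S then ((Real.exp (c w 0) : ℝ) : ℂ) else 1 - (Circle.exp (c w 2 - c w 0) : ℂ))) *
          ∫ z, fH ((archPiEquivCM 2 L Φ₂[L]).symm (fun w => (z w).1 * (endoBlockAt L S w (c w) * (z w).2) * (z w).1⁻¹), (endoTorus L S c).2)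
            ∂(Measure.pi Λw) := by
  obtain ⟨νB, hνB⟩ : ∃ νB : Measure 𝔹[L], νB.IsHaarMeasure := ⟨Measure.haar, inferInstance⟩
  haveI := hνB
  haveI : νB.IsMulRightInvariant := (forall_measure_preimage_mul_right_iff νB).1 fun g A _ => by
    have h : (fun h : 𝔹[L] => h * g) = fun h => g * h := funext fun h => archOne_mul_comm L h g
    rw [h, measure_preimage_mul]
  haveI := isHaarMeasure_prodConventionH L νw νB
  haveI := isMulRightInvariant_prodConventionH L νw νB
  obtain ⟨K₀, hid⟩ := exists_archRH_mul_chartOrbH_eq_of_placeLeaves L S νw νB (((Measure.pi νw).map (archPiEquivCM 2 L Φ₂[L]).symm).prod νB) rfl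
    Λw Zw hZnull Cw hprop hleaf
  refine ⟨haarScalarFactor νH (((Measure.pi νw).map (archPiEquivCM 2 L Φ₂[L]).symm).prod νB) * K₀, fun fH hfH c hc => ?_⟩
  rw [chartOrbH_eq_haarScalarFactor_mul L S νH (((Measure.pi νw).map (archPiEquivCM 2 L Φ₂[L]).symm).prod νB) fH c, ← mul_assoc,
    mul_comm (archRH S c), mul_assoc, hid fH hfH c hc, Complex.ofReal_mul]
  ring

end AnyHaar

end Literature.NumberTheory.Automorphic.UnitaryGroup

end
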